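import Summits.BirchSwinnertonDyer.Rank1Residual.X2.GreenbergVatsalOfUnfoldedFacts
import Summits.BirchSwinnertonDyer.Rank1Residual.X2.GreenbergProp510OfFacts
import HarnessLib

/-!
# Class X2 (odd multiplicative Eisenstein prime): A64 / A63 / `X2.TargetA` and A14 as terms of
# registered facts WITHOUT Greenberg's Prop. 5.10 (A61) — which is now derived in the kernel
# (cell `b2b-bsdres`, unit `b2b-bsdres-eisenstein-p2`, gen 22; corollary file of
# `GreenbergProp510OfFacts.lean` and gen 21's `GreenbergVatsalOfUnfoldedFacts.lean`)

HONEST FRAMING (run/shared/lean/b2b/bsd-rank1-residual/, verbatim in every file): the goal of the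
cell is to DELETE the COMBINATION-SHAPED residual classes of the Birch–Swinnerton-Dyer formula for
ALL analytic-rank `≤ 1` elliptic curves over `ℚ` — "full BSD formula for every rank `≤ 1` curve in
class `C`" assembled STRICTLY from published theorems — so that the rank-`≤ 1` remainder becomes
exactly the CONSTRUCTION-SHAPED classes, which are TYPED (missing-input `Prop`s), NOT attempted.
This is not "finishing BSD". Research route; NO CLAIM BEYOND STATED CLASSES; nothing here changes a
label (X2a stays "CLOSED PUB* modulo `GV00-mult-asserted`" pending the referee; X2b/X2c are
CONSTRUCTION-SHAPED). Theorems only (no definition, no named fact, nothing asserted).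

## What this file proves

Gen 21's four corollaries (`…_of_unfoldedFacts`: A64, A63, `X2.TargetA`, A14 from registered facts
with the reading-fact A196 / p253710 unfolded into F0/F1/F2/F3) with the hypothesis
`hG : Greenberg1999.prop510_isTorsion_hasUnitContent_of_gvPar` (A61, Greenberg LNM 1716 Prop. 5.10)
DISCHARGED by gen 22's `prop510_isTorsion_hasUnitContent_of_gvPar_of_facts : A40 → A41 → F0 → F2 →
F3 → A61`. The registered inputs of the X2a chain after gen 22: A40/A41 (Tate uniformisation),
A133/A135/A137 (GV §2 numbered statements (5)–(7) at `p ‖ N`, Prop. (2.5), p. 15), A195 (GV p. 28/30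
lifting), A180 (GV Cor. (3.8)), F0/F1/F2/F3 (Kubota–Leopoldt existence; GV Thm. (3.11)+(28);
Ferrero–Washington + Mazur–Wiles character identities), Wuthrich Thm. 16, + the rank-0 assembly
facts of `TargetA` — and NO LONGER Greenberg's Prop. 5.10. For A14 (the printed good-ordinary GV
Thm. (1.3)) the Tate facts A40/A41 enter only because A61 is ONE statement for both reduction
types; the good-ordinary half of Prop. 5.10 itself is Tate-free (`prop510_goodOrd_of_facts`).

References: [GreenbergLNM1716] Prop. 5.10 (PDF pp. 147–148); [GreenbergVatsal2000] Thm. (1.3), §2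
(16), pp. 26–30, §3 Thm. (3.11), (26)–(28), p. 43, Cor. (3.8); [Wuthrich2014] Thm. 16;
HOME/b2b-bsdres-eisenstein-p2/X2-GAP.md §27.
-/

set_option autoImplicit false

noncomputable section

open scoped Classical AddSubgroup MatrixGroups ModularForm

open PowerSeries NumberField IsDedekindDomain Field WeierstrassCurve CongruenceSubgroup
  Literature.NumberTheory.EllipticCurves Literature.NumberTheory.EllipticCurves.GreenbergVatsal2000
  Literature.NumberTheory.EllipticCurves.ModularForms
  Literature.NumberTheory.EllipticCurves.Wuthrich2014
  Literature.NumberTheory.EllipticCurves.SteinWuthrich2013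
  Literature.NumberTheory.EllipticCurves.Rank1Residual
  Summit.BirchSwinnertonDyer.Rank1Residual.X2.GreenbergVatsalCaseTwo
  Summit.BirchSwinnertonDyer.Rank1Residual.X2.GreenbergVatsalInputsOfFacts
  Summit.BirchSwinnertonDyer.Rank1Residual.X2.GreenbergVatsalThm13GoodOrdinary
  Summit.BirchSwinnertonDyer.Rank1Residual.X2.EisensteinCongruenceOfFacts
  Summit.BirchSwinnertonDyer.Rank1Residual.X2.GreenbergVatsalOfUnfoldedFacts
  Summit.BirchSwinnertonDyer.Rank1Residual.X2.GreenbergProp510OfFacts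

namespace Summit.BirchSwinnertonDyer.Rank1Residual.X2.GreenbergVatsalOfDerivedProp510

/-- **A64 = `GreenbergVatsal2000.lambda_muAnal_multiplicative_of_gvPar` from registered facts, with
A196 unfolded (gen 21) AND Greenberg's Prop. 5.10 derived (gen 22)** — no `hG` binder.
[cite: GreenbergVatsal2000, Thm. (1.3), §2 (16), pp. 28–30, §3 Thm. (3.11), (28), p. 43, Cor. (3.8)]
[cite: GreenbergLNM1716, Prop. 5.10 (PDF pp. 147–148)] -/
theorem lambda_muAnal_multiplicative_of_gvPar_of_derivedFacts
    (hT : Silverman1994_thmV53_tateUniformisation.{0})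
    (hT' : Silverman1994_thmV53_corV54_tateUniformisation.{0})
    (hA : lambda_nonPrimitive_eq_add_sum_delta_multiplicative)
    (hB : datumSelmer_divisible_of_finite_torsionBy)
    (hF : datumStrictSelmer_lt_datumSelmer_of_split)
    (hLiftF : residualEpsilon_surjOn_of_lineRamifiedEven)
    (hP : cor38_realPeriodRat_eq_unit_mul_of_isIsogenous_of_gvPar)
    (hEx : exists_characterLFunction)
    (h311 : thm311_hasUnitContent_iff_and_order_eq_of_lineRamifiedEven)
    (hC : characterLFunctionC_hasUnitContent_and_order_eq_card)
    (hD : characterLFunctionD_hasUnitContent_and_order_eq_card) :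
    lambda_muAnal_multiplicative_of_gvPar :=
  lambda_muAnal_multiplicative_of_gvPar_of_unfoldedFacts hT hT' hA hB hF
    (prop510_isTorsion_hasUnitContent_of_gvPar_of_facts hT hT' hEx hC hD) hLiftF hP hEx h311 hC hD

/-- **A63 = `GreenbergVatsal2000.lambdaMu_multiplicative_of_gvPar` from registered facts, A196 unfolded
and Prop. 5.10 derived** (+ Wuthrich 2014 Thm. 16 at `p ‖ N`, `hWu`).
[cite: GreenbergVatsal2000, Thm. (1.3), §2 (16), pp. 28–30, §3 Thm. (3.11), (28), p. 43, Cor. (3.8)]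
[cite: Wuthrich2014, Thm. 16 (p. 397)] -/
theorem lambdaMu_multiplicative_of_gvPar_of_derivedFacts
    (hT : Silverman1994_thmV53_tateUniformisation.{0})
    (hT' : Silverman1994_thmV53_corV54_tateUniformisation.{0})
    (hA : lambda_nonPrimitive_eq_add_sum_delta_multiplicative)
    (hB : datumSelmer_divisible_of_finite_torsionBy)
    (hF : datumStrictSelmer_lt_datumSelmer_of_split)
    (hLiftF : residualEpsilon_surjOn_of_lineRamifiedEven)
    (hP : cor38_realPeriodRat_eq_unit_mul_of_isIsogenous_of_gvPar)
    (hEx : exists_characterLFunction)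
    (h311 : thm311_hasUnitContent_iff_and_order_eq_of_lineRamifiedEven)
    (hC : characterLFunctionC_hasUnitContent_and_order_eq_card)
    (hD : characterLFunctionD_hasUnitContent_and_order_eq_card)
    (hWu : thm16_charIdeal_dvd_multiplicative_of_reducible) :
    lambdaMu_multiplicative_of_gvPar :=
  lambdaMu_multiplicative_of_gvPar_of_unfoldedFacts hT hT' hA hB hF
    (prop510_isTorsion_hasUnitContent_of_gvPar_of_facts hT hT' hEx hC hD) hLiftF hP hEx h311 hC hD hWu

/-- **`X2.TargetA` (the X2a closure of record) from registered facts, A196 unfolded and Prop. 5.10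
derived**: gen 21's `targetA_of_unfoldedFacts` with its `hG` binder discharged.
[cite: GreenbergVatsal2000, Thm. (1.3) with pp. 1, 14–15, §3 Thm. (3.11)]
[cite: Wuthrich2014, Thm. 16 (p. 397)] [cite: SteinWuthrich2013, Thm. 6.1 (p. 20)] -/
theorem targetA_of_derivedFacts
    (hT : Silverman1994_thmV53_tateUniformisation.{0})
    (hT' : Silverman1994_thmV53_corV54_tateUniformisation.{0})
    (hA : lambda_nonPrimitive_eq_add_sum_delta_multiplicative)
    (hB : datumSelmer_divisible_of_finite_torsionBy)
    (hF : datumStrictSelmer_lt_datumSelmer_of_split)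
    (hLiftF : residualEpsilon_surjOn_of_lineRamifiedEven)
    (hP : cor38_realPeriodRat_eq_unit_mul_of_isIsogenous_of_gvPar)
    (hEx : exists_characterLFunction)
    (h311 : thm311_hasUnitContent_iff_and_order_eq_of_lineRamifiedEven)
    (hC : characterLFunctionC_hasUnitContent_and_order_eq_card)
    (hD : characterLFunctionD_hasUnitContent_and_order_eq_card)
    (hWu : thm16_charIdeal_dvd_multiplicative_of_reducible)
    (hJs : thm61_splitMultiplicative) (hJn : thm61_nonsplitMultiplicative)
    (hHs : exists_isSplitMultCanonical) (hHn : exists_isMultCanonical)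
    (hGZK : rank_eq_analyticRank_of_analyticRank_le_one) (hmod : hasEntireLFunction_rat)
    (hpar : nonempty_modularParametrizationData)
    (hGS : ∀ (W : WeierstrassCurve ℚ) [W.IsElliptic] [W.IsGloballyMinimal] (p : ℕ) [Fact p.Prime],
      greenberg_stevens (W := W) (p := p)) :
    TargetA :=
  targetA_of_unfoldedFacts hT hT' hA hB hF
    (prop510_isTorsion_hasUnitContent_of_gvPar_of_facts hT hT' hEx hC hD) hLiftF hP hEx h311 hC hD
    hWu hJs hJn hHs hHn hGZK hmod hpar hGS

/-- **A14 = `GreenbergVatsal2000.thm13_charIdeal_eq_of_gvPar` (GV Thm. (1.3) in its PRINTED good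
ordinary setting, with Kato) from registered facts, p253710 unfolded and Prop. 5.10 derived.** NOTE:
the Tate uniformisation facts `hT`/`hT'` appear here only because A61 is ONE statement covering
both reduction types and gen 20's `thm13_charIdeal_eq_of_gvPar_of_facts` takes A61 whole; the
good-ordinary half of Prop. 5.10 is Tate-free (`GreenbergProp510OfFacts.prop510_goodOrd_of_facts`).
[cite: GreenbergVatsal2000, Thm. (1.3), §2 (16), pp. 26–30, §3 Thm. (3.11), (28), p. 43, Cor. (3.8)]
[cite: Wuthrich2014, Thm. 16 (p. 393)] -/
theorem thm13_charIdeal_eq_of_gvPar_of_derivedFacts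
    (hT : Silverman1994_thmV53_tateUniformisation.{0})
    (hT' : Silverman1994_thmV53_corV54_tateUniformisation.{0})
    (hGV : imKummer_ge_greenbergCondition_at_p) (hA : lambda_nonPrimitive_eq_add_sum_delta)
    (hB : divisible_nonPrimitiveSelmerInfty_of_mu_eq_zero)
    (hLiftF : residualEpsilon_surjOn_of_lineRamifiedEven)
    (hP : cor38_realPeriodRat_eq_unit_mul_of_isIsogenous_of_gvPar)
    (hW16 : Wuthrich2014.charIdeal_dvd_padicLFunction)
    (hEx : exists_characterLFunction)
    (h311 : thm311_hasUnitContent_iff_and_order_eq_of_lineRamifiedEven)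
    (hC : characterLFunctionC_hasUnitContent_and_order_eq_card)
    (hD : characterLFunctionD_hasUnitContent_and_order_eq_card) :
    thm13_charIdeal_eq_of_gvPar :=
  thm13_charIdeal_eq_of_gvPar_of_unfoldedFacts hGV hA hB
    (prop510_isTorsion_hasUnitContent_of_gvPar_of_facts hT hT' hEx hC hD) hLiftF hP hW16 hEx h311 hC hD

end Summit.BirchSwinnertonDyer.Rank1Residual.X2.GreenbergVatsalOfDerivedProp510

end
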